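import Literature.Computability.Complexity.AverageCaseDepthHierarchyPSL
import Literature.Computability.Complexity.AverageCaseDepthHierarchyBlockLaw
import HarnessLib

/-!
# One level of the Rossman–Servedio–Tan random projections: independence over the blocks

B. Rossman, R. A. Servedio, L.-Y. Tan, *An average-case depth hierarchy theorem for Boolean
circuits*, arXiv:1504.03398 [RossmanServedioTan2015]: §7.2 Definitions 6 and 9 (pp. 16–18:
`R_init` and `R(τ)` are defined "independently for each `a ∈ A_{k-1}`"), §8 Lemmas 2–3 and
Proposition 2 (pp. 20–22: the strings `Z_a` are independent across blocks, so the stage-wise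
completion is a product distribution), §9.1/§9.5 (pp. 24, 27–29: the projection switching lemmas
for `R_init` and `R(τ)`, whose mass functions are the products "Fact 5"/"Fact 6" of the block laws).

Given a block law `L : BlockLaw` (sibling file `AverageCaseDepthHierarchyBlockLaw`) and a
restriction `τ : BRestr A (Fin w)` of the level, the random projection of the level is the product
weight `L.R τ ρ = ∏_a L.ζ (τ a) (ρ a)` on `BRestr A (Fin w)`. This file proves, by `∏ Σ = Σ ∏` only:

* `BlockLaw.sum_R` (total mass `1`), `BlockLaw.R_nonneg`;
* `BlockLaw.psl_level` — **the projection switching lemma at a level** (RST §9.1, both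
  propositions at once): the `R(τ)`-weight of the restrictions under which a width-`r` DNF with
  repetition-free terms has canonical projection decision tree of depth `≥ s` is at most
  `((8r+10) (1 + t/(1-t))^{r+1} / Γ)^s`, for any `Γ > 0` with `Γ q_n ≤ 1 - λ - q_n` and
  `Γ q_n (1-t)^n ≤ λ (1 - (1-t)^n)` at acceptable sizes (from `RSTProj.psl_abstract` with the
  support and ratio properties of the block law; `κ = (1-t)/t`);
* `BlockLaw.coupling_level` / `coupling_level_exp` — **completion at a level** (RST §8 Prop. 2,
  one stage): drawing `ρ ∼ R(τ)` and filling the stars of every block `a` with a bit `Y_a` drawn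
  from a *fill law* (`IsFillLaw`: any block-local law that is the fresh `t'`-biased bit on blocks
  with a star — in RST's process `Y_a` is the value of `y_a` produced by the later stages) produces
  exactly the product law `plaw τ` (`{•_t, ∘_{1-t}}` on the stars of `τ`, deterministic elsewhere);
  `sum_plaw` (it is a probability mass function).

Nothing numerical is assumed beyond the displayed hypotheses; the parameters of RST (`t_k`, `λ`,
`q`, acceptability) are plugged in by the sibling files.
-/

noncomputable section

namespace Literature.Computability.Complexity

namespace RSTProj

open Finset

namespace BlockLaw

variable (L : BlockLaw) {A : Type*} [Fintype A] [DecidableEq A] {w : ℕ}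

/-! ### The product law of a level -/

/-- The random projection of a level: independent blocks, each with the block law of `τ_a`
(`R_init` for `τ = ⋆`, `t = 1/2`; `R(τ)` otherwise). [cite: RossmanServedioTan2015, §7.2 Defs. 6, 9 (pp. 16–18, "independently for each `a`") and §9.5 Facts 5–6 (p. 27–28)] -/
def R (τ ρ : BRestr A (Fin w)) : ℝ := ∏ a, L.ζ (τ a) (ρ a)

/-- **Total mass one.** [cite: RossmanServedioTan2015, §7.2 Def. 9 (p. 18)] -/
theorem sum_R (ht0 : 0 < L.t) (ht1 : L.t ≤ 1) (τ : BRestr A (Fin w)) : ∑ ρ : BRestr A (Fin w), L.R τ ρ = 1 := by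
  classical
  have h := Finset.prod_univ_sum (fun (_ : A) => (univ : Finset (Fin w → Option Bool))) (fun a ϱ => L.ζ (τ a) ϱ)
  simp only [Fintype.piFinset_univ] at h
  unfold R
  rw [← h]
  simp [L.sum_ζ ht0 ht1]

omit [DecidableEq A] in
/-- Nonnegativity of the level law. [cite: RossmanServedioTan2015, §7.2 Remark 3 (p. 18)] -/
theorem R_nonneg (ht0 : 0 < L.t) (ht1 : L.t ≤ 1) (hlam : 0 ≤ L.lam)
    (hq : ∀ n, L.acc n = true → 1 ≤ n → 0 ≤ L.qa n ∧ L.qa n ≤ 1 - L.lam) (τ ρ : BRestr A (Fin w)) :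
    0 ≤ L.R τ ρ :=
  Finset.prod_nonneg fun _ _ => L.ζ_nonneg ht0 ht1 hlam hq _ _

/-! ### The projection switching lemma at a level -/

/-- **Projection switching lemma for `R_init` / `R(τ)`** (RST §9.1, the two propositions, in counting
form with explicit constants): for a DNF `F` over the variables `A × Fin w` of the level, with
repetition-free terms of width `≤ r`, `s ≥ 1`, `0 < t ≤ 1/2`, and `Γ > 0` satisfying the two ratio
conditions at every acceptable size, the `R(τ)`-probability that `Tree(F↾ρ)` has depth `≥ s` is at
most `((8r+10)(1 + t/(1-t))^{r+1}/Γ)^s`. (RST: `(O(r 2^r w^{-1/4}))^s` resp.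
`(O(r e^{r t_k/(1-t_k)} w^{-1/4}))^s`, `Γ = Ω(w^{1/4})`.) [cite: RossmanServedioTan2015, §9.1 (p. 24) and §9.5 (pp. 27–29)] -/
theorem psl_level (ht0 : 0 < L.t) (ht2 : L.t ≤ 1 / 2) (hlam : 0 ≤ L.lam) {Γ : ℝ} (hΓ : 0 < Γ)
    (hq : ∀ n, L.acc n = true → 1 ≤ n →
      0 < L.qa n ∧ L.qa n ≤ 1 - L.lam ∧ Γ * L.qa n ≤ 1 - L.lam - L.qa n ∧
        Γ * L.qa n * (1 - L.t) ^ n ≤ L.lam * (1 - (1 - L.t) ^ n))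
    (τ : BRestr A (Fin w)) (F : CNF (A × Fin w)) (hF : ∀ T ∈ F, VarNodup T) {r : ℕ}
    (hr : ∀ T ∈ F, T.length ≤ r) {s : ℕ} (hs : 1 ≤ s) :
    ∑ ρ ∈ univ.filter (fun ρ : BRestr A (Fin w) => s ≤ pcdt F ρ), L.R τ ρ ≤
      ((8 * r + 10) * (1 + L.t / (1 - L.t)) ^ (r + 1) / Γ) ^ s := by
  classical
  have ht1 : L.t < 1 := by linarith
  have hκ : 1 ≤ (1 - L.t) / L.t := by rw [le_div_iff₀ ht0]; linarith
  have hq' : ∀ n, L.acc n = true → 1 ≤ n → 0 ≤ L.qa n ∧ L.qa n ≤ 1 - L.lam :=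
    fun n hn h1 => ⟨(hq n hn h1).1.le, (hq n hn h1).2.1⟩
  have hq'' : ∀ n, L.acc n = true → 1 ≤ n →
      0 < L.qa n ∧ Γ * L.qa n ≤ 1 - L.lam - L.qa n ∧ Γ * L.qa n * (1 - L.t) ^ n ≤ L.lam * (1 - (1 - L.t) ^ n) :=
    fun n hn h1 => ⟨(hq n hn h1).1, (hq n hn h1).2.2.1, (hq n hn h1).2.2.2⟩
  have h := psl_abstract (A := A) (P := Fin w) (fun a ϱ => L.ζ (τ a) ϱ) (fun _ ϱ => L.ζ_nonneg ht0 ht1.le hlam hq' _ _)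
    (!L.o) hΓ hκ
    (fun _ ϱ hpos ⟨i, hi⟩ j => L.no_bullet_of_ζ_ne_zero_of_star hpos.ne' hi j)
    (fun _ ϱ g hpos hstar => by
      have := L.ratio_of_star ht0 ht1 hq'' hpos hstar g
      have e : (univ.filter fun i => ϱ i = none ∧ g i = !!L.o) = (univ.filter fun i => ϱ i = none ∧ g i = L.o) := by
        rw [Bool.not_not]
      rw [e]; exact this)
    F hF hr hs
  have hmass : ∑ ρ : BRestr A (Fin w), bw (fun a ϱ => L.ζ (τ a) ϱ) ρ = 1 := L.sum_R ht0 ht1.le τ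
  rw [hmass, one_mul] at h
  have hinv : ((1 - L.t) / L.t)⁻¹ = L.t / (1 - L.t) := by rw [inv_div]
  rw [hinv] at h
  exact h

/-! ### Completion of one stage to the product law of the level -/

/-- The law of the independent bit filling the stars of a block: `∘` with probability `t'`. [cite: RossmanServedioTan2015, §8 Lemma 3 (p. 21, `Y ← {0_{1-t_{k-1}}, 1_{t_{k-1}}}`)] -/
def bern (b : Bool) : ℝ := if b = L.o then L.t' else 1 - L.t'

/-- The fill bit has total mass one. [folklore] -/
theorem sum_bern : ∑ b : Bool, L.bern b = 1 := by
  rw [Fintype.sum_bool]; cases ho : L.o <;> simp [bern, ho]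

/-- **The product law of the level** under `τ`: on every block the `{•_t, ∘_{1-t}}` law on the stars
of `τ_a`, the fixed values of `τ_a` elsewhere. [cite: RossmanServedioTan2015, §8 Lemma 3 (p. 21, "distributed according to `{0_{t_k},1_{1-t_k}}^{S_a}`")] -/
def plaw (τ : BRestr A (Fin w)) (Z : A → Fin w → Bool) : ℝ := ∏ a, prodW (τ a) L.L3 (fun i => some (Z a i))

/-- Filling the stars of every block `a` of `ρ` with the bit `Y_a` (RST eq. (16); this is
`BRestr.expand`, curried). [cite: RossmanServedioTan2015, §8 Prop. 2 (p. 22, eq. (16))] -/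
def fillB (ρ : BRestr A (Fin w)) (Y : A → Bool) : A → Fin w → Bool := fun a i => (ρ a i).getD (Y a)

omit [Fintype A] [DecidableEq A] in
/-- `fillB` is `expand`. [folklore] -/
theorem fillB_eq_expand (ρ : BRestr A (Fin w)) (Y : A → Bool) (a : A) (i : Fin w) :
    fillB ρ Y a i = ρ.expand Y (a, i) := rfl

/-- On one block the bullet product law is a probability mass function on the total strings. [folklore] -/
theorem sum_prodW_L3_total (τa : Fin w → Option Bool) :
    ∑ za : Fin w → Bool, prodW τa L.L3 (fun i => some (za i)) = 1 := by
  classical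
  have h := Finset.prod_univ_sum (fun (_ : Fin w) => (univ : Finset Bool))
    (fun i b => if τa i = none then L.L3 (some b) else if some b = τa i then 1 else 0)
  simp only [Fintype.piFinset_univ] at h
  unfold prodW
  rw [← h]
  refine Finset.prod_eq_one fun i _ => ?_
  rw [Fintype.sum_bool]
  cases hτ : τa i with
  | none => cases ho : L.o <;> simp [L3, ho]
  | some c => cases c <;> simp

/-- The product law of the level has total mass one. [cite: RossmanServedioTan2015, §8 Lemma 3 (p. 21)] -/
theorem sum_plaw (τ : BRestr A (Fin w)) : ∑ Z : A → Fin w → Bool, L.plaw τ Z = 1 := by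
  classical
  have h := Finset.prod_univ_sum (fun (_ : A) => (univ : Finset (Fin w → Bool)))
    (fun a za => prodW (τ a) L.L3 (fun i => some (za i)))
  simp only [Fintype.piFinset_univ] at h
  unfold plaw
  rw [← h]
  simp [L.sum_prodW_L3_total]

omit [DecidableEq A] in
/-- Nonnegativity of the product law (`0 ≤ t ≤ 1`). [folklore] -/
theorem plaw_nonneg (ht0 : 0 ≤ L.t) (ht1 : L.t ≤ 1) (τ : BRestr A (Fin w)) (Z : A → Fin w → Bool) :
    0 ≤ L.plaw τ Z :=
  Finset.prod_nonneg fun _ _ => prodW_nonneg _ (L.L3_nonneg ht0 ht1) _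

/-- A *fill law*: the law of the bit filling the stars of a block may depend on the block string,
must be a probability mass function, and must be the independent `t'`-biased bit whenever the block
actually has a star (and no bullet — the other strings have weight `0`). In RST's process the bit
`Y_a` is the value of the level-`(k-1)` variable `y_a` produced by the LATER stages, whose law,
given the present block, is of this kind (Prop. 2). [cite: RossmanServedioTan2015, §8 Prop. 2 (p. 22)] -/
structure IsFillLaw (κ : (Fin w → Option Bool) → Bool → ℝ) : Prop where
  /-- total mass one for every block string -/
  sum_eq_one : ∀ ϱ, ∑ b : Bool, κ ϱ b = 1
  /-- on a block with a star and no bullet it is the fresh biased bit -/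
  eq_bern : ∀ ϱ, (∃ i, ϱ i = none) → (∀ i, ϱ i ≠ some (!L.o)) → ∀ b, κ ϱ b = L.bern b

/-- The constant fresh bit is a fill law. [folklore] -/
theorem isFillLaw_bern : L.IsFillLaw (fun (_ : Fin w → Option Bool) b => L.bern b) :=
  ⟨fun _ => L.sum_bern, fun _ _ _ _ => rfl⟩

/-- **Block coupling for a fill law**: as `BlockLaw.coupling`, with the fresh bit replaced by any
fill law (the difference is invisible: blocks without stars read no bit, blocks with stars and
positive weight have no bullet). [cite: RossmanServedioTan2015, §8 Lemmas 2–3 (pp. 20–21)] -/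
theorem coupling_fill (ht0 : 0 < L.t) (ht1 : L.t ≤ 1) (ht' : L.t' ≠ 0) {κ : (Fin w → Option Bool) → Bool → ℝ}
    (hκ : L.IsFillLaw κ) (τa : Fin w → Option Bool) (za : Fin w → Bool) :
    ∑ ϱ : Fin w → Option Bool, L.ζ τa ϱ * ∑ b : Bool, κ ϱ b * (if (∀ i, (ϱ i).getD b = za i) then 1 else 0) =
      prodW τa L.L3 (fun i => some (za i)) := by
  classical
  rw [← L.coupling ht0 ht1 ht' τa za]
  refine Finset.sum_congr rfl fun ϱ _ => ?_
  by_cases h0 : L.ζ τa ϱ = 0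
  · rw [h0, zero_mul, zero_mul]
  congr 1
  by_cases hstar : ∃ i, ϱ i = none
  · obtain ⟨i, hi⟩ := hstar
    have hnb := L.no_bullet_of_ζ_ne_zero_of_star h0 hi
    unfold cpl
    exact Finset.sum_congr rfl fun b _ => by rw [hκ.eq_bern ϱ ⟨i, hi⟩ hnb b, bern]
  · push Not at hstar
    have key : ∀ b : Bool, (∀ i, (ϱ i).getD b = za i) ↔ ϱ = fun i => some (za i) := by
      intro b
      constructor
      · intro h; funext i
        cases hϱ : ϱ i with
        | none => exact absurd hϱ (hstar i)
        | some c => have := h i; rw [hϱ] at this; simpa using this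
      · intro h i; rw [h]; rfl
    rw [L.cpl_of_total hstar]
    simp only [key]
    by_cases h : ϱ = fun i => some (za i)
    · simp only [if_pos h, mul_one]; exact hκ.sum_eq_one ϱ
    · simp [if_neg h]

/-- **Completion at a level, mass-function form** (RST §8 Lemma 2 / Lemma 3 with the independence
across blocks, Prop. 2): the law of `fillB ρ Y` for `ρ ∼ R(τ)` and `Y` drawn from a product of fill
laws `∏_a κ(ρ_a)(Y_a)` is `plaw τ`. [cite: RossmanServedioTan2015, §8 Lemmas 2–3, Prop. 2 (pp. 20–22, "`Z_a` and `Z_{a'}` are independent")] -/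
theorem coupling_level (ht0 : 0 < L.t) (ht1 : L.t ≤ 1) (ht' : L.t' ≠ 0) {κ : (Fin w → Option Bool) → Bool → ℝ}
    (hκ : L.IsFillLaw κ) (τ : BRestr A (Fin w)) (z : A → Fin w → Bool) :
    ∑ ρ : BRestr A (Fin w), ∑ Y : A → Bool, L.R τ ρ * (∏ a, κ (ρ a) (Y a)) * (if fillB ρ Y = z then 1 else 0) =
      L.plaw τ z := by
  classical
  -- the indicator of the product event is the product of the block indicators
  have hind : ∀ (ρ : BRestr A (Fin w)) (Y : A → Bool), (if fillB ρ Y = z then (1 : ℝ) else 0) =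
      ∏ a, (if (∀ i, (ρ a i).getD (Y a) = z a i) then (1 : ℝ) else 0) := by
    intro ρ Y
    by_cases h : fillB ρ Y = z
    · rw [if_pos h]
      refine (Finset.prod_eq_one fun a _ => ?_).symm
      rw [if_pos]; intro i; exact congrFun (congrFun h a) i
    · rw [if_neg h]
      have : ∃ a, ¬ (∀ i, (ρ a i).getD (Y a) = z a i) := by
        by_contra hall; push Not at hall
        exact h (funext fun a => funext fun i => hall a i)
      obtain ⟨a, ha⟩ := this
      exact (Finset.prod_eq_zero (Finset.mem_univ a) (if_neg ha)).symm
  -- factorise the double sum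
  have step1 : ∀ ρ : BRestr A (Fin w), ∑ Y : A → Bool, L.R τ ρ * (∏ a, κ (ρ a) (Y a)) * (if fillB ρ Y = z then 1 else 0) =
      ∏ a, (L.ζ (τ a) (ρ a) * ∑ b : Bool, κ (ρ a) b * (if (∀ i, (ρ a i).getD b = z a i) then 1 else 0)) := by
    intro ρ
    have h := Finset.prod_univ_sum (fun (_ : A) => (univ : Finset Bool))
      (fun a b => L.ζ (τ a) (ρ a) * (κ (ρ a) b * (if (∀ i, (ρ a i).getD b = z a i) then 1 else 0)))
    simp only [Fintype.piFinset_univ] at h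
    have e : ∀ Y : A → Bool, L.R τ ρ * (∏ a, κ (ρ a) (Y a)) * (if fillB ρ Y = z then 1 else 0) =
        ∏ a, (L.ζ (τ a) (ρ a) * (κ (ρ a) (Y a) * (if (∀ i, (ρ a i).getD (Y a) = z a i) then 1 else 0))) := by
      intro Y
      rw [hind, R, ← Finset.prod_mul_distrib, ← Finset.prod_mul_distrib]
      refine Finset.prod_congr rfl fun a _ => by ring
    rw [Finset.sum_congr rfl fun Y _ => e Y, ← h]
    refine Finset.prod_congr rfl fun a _ => ?_
    rw [Finset.mul_sum]
  rw [Finset.sum_congr rfl fun ρ _ => step1 ρ]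
  have h := Finset.prod_univ_sum (fun (_ : A) => (univ : Finset (Fin w → Option Bool)))
    (fun a ϱ => L.ζ (τ a) ϱ * ∑ b : Bool, κ ϱ b * (if (∀ i, (ϱ i).getD b = z a i) then 1 else 0))
  simp only [Fintype.piFinset_univ] at h
  rw [← h, plaw]
  exact Finset.prod_congr rfl fun a _ => L.coupling_fill ht0 ht1 ht' hκ (τ a) (z a)

/-- **Completion at a level, expectation form**: for every function `φ` of the completed level,
`E_{ρ∼R(τ)} E_{Y∼κ(ρ)} φ(fill(ρ, Y)) = E_{Z∼plaw(τ)} φ(Z)`. [cite: RossmanServedioTan2015, §8 Prop. 1/2 (pp. 20–23)] -/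
theorem coupling_level_exp (ht0 : 0 < L.t) (ht1 : L.t ≤ 1) (ht' : L.t' ≠ 0) {κ : (Fin w → Option Bool) → Bool → ℝ}
    (hκ : L.IsFillLaw κ) (τ : BRestr A (Fin w)) (φ : (A → Fin w → Bool) → ℝ) :
    ∑ ρ : BRestr A (Fin w), L.R τ ρ * ∑ Y : A → Bool, (∏ a, κ (ρ a) (Y a)) * φ (fillB ρ Y) =
      ∑ Z : A → Fin w → Bool, L.plaw τ Z * φ Z := by
  classical
  have hφ : ∀ x : A → Fin w → Bool, φ x = ∑ z : A → Fin w → Bool, (if x = z then (1 : ℝ) else 0) * φ z := by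
    intro x
    simp only [boole_mul]
    rw [Finset.sum_ite_eq]; simp
  calc ∑ ρ : BRestr A (Fin w), L.R τ ρ * ∑ Y : A → Bool, (∏ a, κ (ρ a) (Y a)) * φ (fillB ρ Y)
      = ∑ ρ : BRestr A (Fin w), ∑ Y : A → Bool, ∑ z : A → Fin w → Bool,
          L.R τ ρ * (∏ a, κ (ρ a) (Y a)) * (if fillB ρ Y = z then 1 else 0) * φ z := by
        refine Finset.sum_congr rfl fun ρ _ => ?_
        rw [Finset.mul_sum]
        refine Finset.sum_congr rfl fun Y _ => ?_
        rw [hφ (fillB ρ Y), Finset.mul_sum, Finset.mul_sum]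
        refine Finset.sum_congr rfl fun z _ => by ring
    _ = ∑ ρ : BRestr A (Fin w), ∑ z : A → Fin w → Bool, ∑ Y : A → Bool,
          L.R τ ρ * (∏ a, κ (ρ a) (Y a)) * (if fillB ρ Y = z then 1 else 0) * φ z :=
        Finset.sum_congr rfl fun ρ _ => Finset.sum_comm
    _ = ∑ z : A → Fin w → Bool, ∑ ρ : BRestr A (Fin w), ∑ Y : A → Bool,
          L.R τ ρ * (∏ a, κ (ρ a) (Y a)) * (if fillB ρ Y = z then 1 else 0) * φ z := Finset.sum_comm
    _ = ∑ z : A → Fin w → Bool, (∑ ρ : BRestr A (Fin w), ∑ Y : A → Bool,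
          L.R τ ρ * (∏ a, κ (ρ a) (Y a)) * (if fillB ρ Y = z then 1 else 0)) * φ z := by
        refine Finset.sum_congr rfl fun z _ => ?_
        rw [Finset.sum_mul]
        refine Finset.sum_congr rfl fun ρ _ => ?_
        rw [Finset.sum_mul]
    _ = ∑ z : A → Fin w → Bool, L.plaw τ z * φ z := by
        refine Finset.sum_congr rfl fun z _ => ?_
        rw [L.coupling_level ht0 ht1 ht' hκ τ z]

end BlockLaw

end RSTProj

end Literature.Computability.Complexity

end
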